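import Mathlib
import Literature.MathematicalPhysics.StatisticalMechanics.BarlowStacking
import Literature.MathematicalPhysics.StatisticalMechanics.PeriodicConfigurationSums

/-!
# Route `EnergyDerivativeOrder`, item `DanskinStep` (stmt-AtomisticToContinuum-12282):
# lattice sums of the relaxed hcp family against a compactly supported test potential

Helper file for the Danskin step of route
`AtomisticToContinuum/Crystallization/EnergyDerivativeOrder`.
For the two-parameter family `hcp(a,h) = hcpPeriodicConfiguration ha hh` (in-layer spacing `a`,
layer spacing `h`; `BarlowStacking.lean`) and the energy per particle
`e_P(V) = (2·#F)⁻¹ ∑_{x ∈ F} ∑'_{y ∈ P, y ≠ x} V(|x − y|)` (Blanc–Lewin 2015, (23);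
`PeriodicConfiguration.energyPerParticle`) we prove:

* `summable_site_of_finRange`, `energyPerParticle_lennardJones_add_mul` — a finite-range site
  family on a periodic configuration of `ℝ³` is summable, hence the energy per particle is linear
  along the segment `V_LJ + tW`: `e_P(V_LJ + tW) = e_P(V_LJ) + t·e_P(W)`;
* `tsum_points_eq_tsum_ite`, `tsum_hcp_site_eq` — the site sums of `hcp(a,h)` re-indexed by `ℤ³`
  through the injective point map `(k,i,j) ↦ barlowPos a h alternatingHagg k i j`;
* `dist_hcp_mono` — the mutual distances of the family are monotone in `(a,h)`;
  `continuous_dist_hcp` — and continuous in `(a,h)`;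
* `exists_continuous_hcp_energyPerParticle` — **for a continuous compactly supported `W` there
  is a continuous `g : ℝ × ℝ → ℝ` with `e_{hcp(a,h)}(W) = g(a,h)` whenever `a, h ≥ 1/2`**: on that
  quadrant only the finitely many index vectors that are within the range of `W` already at
  `(a,h) = (1/2,1/2)` contribute, so the lattice sum is a finite sum of continuous functions.

All `[folklore]`; the re-indexing lemmas are adapted from
`Theorems/ExcessDecayLiouvilleCoarseGrainsHcpEnergySeries.lean` (where they are private and
specialised to `V_LJ`).
-/

noncomputable section

namespace Summit.AtomisticToContinuum.Crystallization.Theorems.EnergyDerivativeOrderDanskin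

open Literature.MathematicalPhysics.StatisticalMechanics
open scoped BigOperators Topology
open Filter Set Metric

/-! ## Finite-range site families; linearity of the energy per particle -/

/-- A finite-range site family on a periodic configuration of `ℝ³` is finitely supported (the
configuration is locally finite, `PeriodicConfiguration.finite_inter_points`). [folklore] -/
theorem finite_support_site_of_finRange (P : PeriodicConfiguration 3) {W : ℝ → ℝ} {ρ : ℝ}
    (hW : ∀ r, ρ < r → W r = 0) (p : EuclideanSpace ℝ (Fin 3)) :
    (Function.support fun q : {q : EuclideanSpace ℝ (Fin 3) // q ∈ P.points ∧ q ≠ p} =>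
      W (dist p q.1)).Finite := by
  have hfin := P.finite_inter_points (Metric.isBounded_closedBall (x := p) (r := ρ))
  refine (hfin.preimage Subtype.val_injective.injOn).subset ?_
  intro q hq
  refine ⟨?_, q.2.1⟩
  rw [Metric.mem_closedBall, dist_comm]
  by_contra hle
  exact hq (hW _ (not_le.1 hle))

/-- Hence a finite-range site family is summable. [folklore] -/
theorem summable_site_of_finRange (P : PeriodicConfiguration 3) {W : ℝ → ℝ} {ρ : ℝ}
    (hW : ∀ r, ρ < r → W r = 0) (p : EuclideanSpace ℝ (Fin 3)) :
    Summable fun q : {q : EuclideanSpace ℝ (Fin 3) // q ∈ P.points ∧ q ≠ p} => W (dist p q.1) :=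
  summable_of_hasFiniteSupport (finite_support_site_of_finRange P hW p)

/-- **Linearity of the energy per particle along `V_LJ + tW`** for a finite-range `W` on a
periodic configuration of `ℝ³`: `e_P(V_LJ + tW) = e_P(V_LJ) + t·e_P(W)` (both site families are
summable: Lennard-Jones by `summable_lennardJones_dist_three`, `W` by finite range). [folklore] -/
theorem energyPerParticle_lennardJones_add_mul (P : PeriodicConfiguration 3) {W : ℝ → ℝ} {ρ : ℝ}
    (hW : ∀ r, ρ < r → W r = 0) (t : ℝ) :
    P.energyPerParticle (fun r => lennardJones r + t * W r) =
      P.energyPerParticle lennardJones + t * P.energyPerParticle W := by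
  have key : ∀ x ∈ P.motif,
      ∑' q : {q : EuclideanSpace ℝ (Fin 3) // q ∈ P.points ∧ q ≠ x},
        (lennardJones (dist x q.1) + t * W (dist x q.1)) =
      ∑' q : {q : EuclideanSpace ℝ (Fin 3) // q ∈ P.points ∧ q ≠ x}, lennardJones (dist x q.1) +
        t * ∑' q : {q : EuclideanSpace ℝ (Fin 3) // q ∈ P.points ∧ q ≠ x}, W (dist x q.1) := by
    intro x _
    rw [(P.summable_lennardJones_dist_three x).tsum_add
      ((summable_site_of_finRange P hW x).mul_left t), tsum_mul_left]
  unfold PeriodicConfiguration.energyPerParticle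
  rw [Finset.sum_congr rfl key, Finset.sum_add_distrib, ← Finset.mul_sum]
  ring

/-! ## Re-indexing the site sums of `hcp(a,h)` by `ℤ³` -/

/-- The indicator of a punctured point set, pulled back along an injection `ψ` with `ψ v₀ = x` and
range the point set, is the family `if v = v₀ then 0 else F (ψ v)`. [folklore] -/
theorem indicator_comp_eq_ite {ι : Type*} [DecidableEq ι] {S : Set (EuclideanSpace ℝ (Fin 3))}
    {x : EuclideanSpace ℝ (Fin 3)} {ψ : ι → EuclideanSpace ℝ (Fin 3)} {v₀ : ι}
    (hinj : Function.Injective ψ) (h0 : ψ v₀ = x) (hS : ∀ y, y ∈ S ↔ ∃ v, ψ v = y)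
    (F : EuclideanSpace ℝ (Fin 3) → ℝ) (v : ι) :
    {y | y ∈ S ∧ y ≠ x}.indicator F (ψ v) = if v = v₀ then 0 else F (ψ v) := by
  by_cases hv : v = v₀
  · rw [if_pos hv, Set.indicator_of_notMem]
    simp [hv, h0]
  · rw [if_neg hv, Set.indicator_of_mem]
    exact ⟨(hS _).2 ⟨v, rfl⟩, fun he => hv (hinj (he.trans h0.symm))⟩

/-- The support of that indicator lies in the range of `ψ`. [folklore] -/
theorem support_indicator_subset_range {ι : Type*} {S : Set (EuclideanSpace ℝ (Fin 3))}
    {x : EuclideanSpace ℝ (Fin 3)} {ψ : ι → EuclideanSpace ℝ (Fin 3)}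
    (hS : ∀ y, y ∈ S ↔ ∃ v, ψ v = y) (F : EuclideanSpace ℝ (Fin 3) → ℝ) :
    Function.support ({y | y ∈ S ∧ y ≠ x}.indicator F) ⊆ Set.range ψ := fun y hy => by
  obtain ⟨v, hv⟩ := (hS y).1 (Set.support_indicator_subset hy).1
  exact ⟨v, hv⟩

/-- **Re-indexing a punctured site sum.** If `ψ : ι → ℝ³` is injective with `ψ v₀ = x` and range
`S`, then `∑'_{y ∈ S, y ≠ x} F y = ∑'_{v} (if v = v₀ then 0 else F (ψ v))` (no summability needed).
[folklore] -/
theorem tsum_points_eq_tsum_ite {ι : Type*} [DecidableEq ι] {S : Set (EuclideanSpace ℝ (Fin 3))}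
    {x : EuclideanSpace ℝ (Fin 3)} {ψ : ι → EuclideanSpace ℝ (Fin 3)} {v₀ : ι}
    (hinj : Function.Injective ψ) (h0 : ψ v₀ = x) (hS : ∀ y, y ∈ S ↔ ∃ v, ψ v = y)
    (F : EuclideanSpace ℝ (Fin 3) → ℝ) :
    ∑' y : {y // y ∈ S ∧ y ≠ x}, F y.1 = ∑' v : ι, if v = v₀ then 0 else F (ψ v) :=
  calc ∑' y : {y // y ∈ S ∧ y ≠ x}, F y.1
      = ∑' y, {y | y ∈ S ∧ y ≠ x}.indicator F y := tsum_subtype {y | y ∈ S ∧ y ≠ x} F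
    _ = ∑' v, {y | y ∈ S ∧ y ≠ x}.indicator F (ψ v) :=
        (hinj.tsum_eq (support_indicator_subset_range hS F)).symm
    _ = _ := tsum_congr (indicator_comp_eq_ite hinj h0 hS F)

/-- **The hcp point map `(k,i,j) ↦ barlowPos a h alternatingHagg k i j` is injective** for
`a ≠ 0`, `h ≠ 0` (third coordinate `k h` fixes `k`, then the second fixes `j`, then the first
fixes `i`). [folklore] -/
theorem hcp_injective {a h : ℝ} (ha : a ≠ 0) (hh : h ≠ 0) :
    Function.Injective fun v : ℤ × ℤ × ℤ => barlowPos a h alternatingHagg v.1 v.2.1 v.2.2 := by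
  rintro ⟨k, i, j⟩ ⟨k', i', j'⟩ heq
  have e2 := congrArg (fun z : EuclideanSpace ℝ (Fin 3) => z 2) heq
  have e1 := congrArg (fun z : EuclideanSpace ℝ (Fin 3) => z 1) heq
  have e0 := congrArg (fun z : EuclideanSpace ℝ (Fin 3) => z 0) heq
  simp only [barlowPos_apply_two, barlowPos_apply_one, barlowPos_apply_zero] at e0 e1 e2
  have hk : k = k' := by
    have : (k : ℝ) = k' := mul_right_cancel₀ hh e2
    exact_mod_cast this
  subst hk
  have h3 : (√3 : ℝ) ≠ 0 := by positivity
  have hj : j = j' := by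
    have hc : a * √3 / 2 ≠ 0 := div_ne_zero (mul_ne_zero ha h3) two_ne_zero
    have : (j : ℝ) = j' := by
      have := mul_left_cancel₀ hc e1
      linarith
    exact_mod_cast this
  subst hj
  have hi : i = i' := by
    have : (i : ℝ) = i' := by
      have := mul_left_cancel₀ ha e0
      linarith
    exact_mod_cast this
  subst hi
  rfl

/-- The range of the hcp point map is the point set of `hcpPeriodicConfiguration ha hh`
(`hcpPeriodicConfiguration_points`). [folklore] -/
theorem mem_hcp_points_iff {a h : ℝ} (ha : a ≠ 0) (hh : h ≠ 0)
    (y : EuclideanSpace ℝ (Fin 3)) :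
    y ∈ (hcpPeriodicConfiguration ha hh).points ↔
      ∃ v : ℤ × ℤ × ℤ, barlowPos a h alternatingHagg v.1 v.2.1 v.2.2 = y := by
  rw [hcpPeriodicConfiguration_points, hcpStacking, mem_barlowStacking_iff]
  constructor
  · rintro ⟨k, i, j, rfl⟩
    exact ⟨(k, i, j), rfl⟩
  · rintro ⟨⟨k, i, j⟩, rfl⟩
    exact ⟨k, i, j, rfl⟩

/-- **The site sum of `hcp(a,h)` at the lattice point of index `v₀`, as a `ℤ³`-series**:
`∑'_{y ∈ hcp, y ≠ Φ v₀} F y = ∑'_{v ∈ ℤ³} (if v = v₀ then 0 else F (Φ v))`. [folklore] -/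
theorem tsum_hcp_site_eq {a h : ℝ} (ha : a ≠ 0) (hh : h ≠ 0) (v₀ : ℤ × ℤ × ℤ)
    (F : EuclideanSpace ℝ (Fin 3) → ℝ) :
    ∑' y : {y // y ∈ (hcpPeriodicConfiguration ha hh).points ∧
        y ≠ barlowPos a h alternatingHagg v₀.1 v₀.2.1 v₀.2.2}, F y.1 =
      ∑' v : ℤ × ℤ × ℤ, if v = v₀ then 0 else F (barlowPos a h alternatingHagg v.1 v.2.1 v.2.2) :=
  tsum_points_eq_tsum_ite (ψ := fun v : ℤ × ℤ × ℤ => barlowPos a h alternatingHagg v.1 v.2.1 v.2.2)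
    (hcp_injective ha hh) rfl (mem_hcp_points_iff ha hh) F

/-! ## Distances in the family `hcp(a,h)`: monotone and continuous in `(a,h)` -/

/-- **Mutual distances of the relaxed hcp family are monotone in the two spacings**: for
`0 ≤ a₁ ≤ a` and `0 ≤ h₁ ≤ h`, corresponding pairs of points of `hcp(a₁,h₁)` are no farther apart
than in `hcp(a,h)` (the squared distance is `a²·q + (k − k')²·h²` with `q ≥ 0`,
`dist_barlowPos_sq`). [folklore] -/
theorem dist_hcp_mono {a₁ h₁ a h : ℝ} (ha₁ : 0 ≤ a₁) (ha : a₁ ≤ a) (hh₁ : 0 ≤ h₁) (hh : h₁ ≤ h)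
    (k i j k' i' j' : ℤ) :
    dist (barlowPos a₁ h₁ alternatingHagg k i j) (barlowPos a₁ h₁ alternatingHagg k' i' j') ≤
      dist (barlowPos a h alternatingHagg k i j) (barlowPos a h alternatingHagg k' i' j') := by
  rw [← pow_le_pow_iff_left₀ dist_nonneg dist_nonneg two_ne_zero, dist_barlowPos_sq,
    dist_barlowPos_sq]
  have hsq : ∀ (c₁ c Z : ℝ), 0 ≤ c₁ → c₁ ≤ c → (c₁ * Z) ^ 2 ≤ (c * Z) ^ 2 := fun c₁ c Z h0 hle => by
    rw [mul_pow, mul_pow]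
    exact mul_le_mul_of_nonneg_right (pow_le_pow_left₀ h0 hle 2) (sq_nonneg Z)
  refine add_le_add (add_le_add (hsq _ _ _ ha₁ ha) ?_) ?_
  · have e : ∀ c : ℝ, c * √3 / 2 *
        (((j : ℝ) - j') + ((haggLabel alternatingHagg k : ℝ) - haggLabel alternatingHagg k') / 3) =
        c * (√3 / 2 *
        (((j : ℝ) - j') +
          ((haggLabel alternatingHagg k : ℝ) - haggLabel alternatingHagg k') / 3)) :=
      fun c => by ring
    rw [e, e]
    exact hsq _ _ _ ha₁ ha
  · rw [mul_comm _ h₁, mul_comm _ h]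
    exact hsq _ _ _ hh₁ hh

/-- **Mutual distances of the relaxed hcp family are continuous in the two spacings.**
[folklore] -/
theorem continuous_dist_hcp (k i j k' i' j' : ℤ) :
    Continuous fun p : ℝ × ℝ =>
      dist (barlowPos p.1 p.2 alternatingHagg k i j)
        (barlowPos p.1 p.2 alternatingHagg k' i' j') := by
  have e : (fun p : ℝ × ℝ =>
      dist (barlowPos p.1 p.2 alternatingHagg k i j) (barlowPos p.1 p.2 alternatingHagg k' i' j')) =
      fun p : ℝ × ℝ => Real.sqrt
        ((p.1 * ((i - i') + (j - j') / 2 +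
          (haggLabel alternatingHagg k - haggLabel alternatingHagg k') / 2)) ^ 2 +
        (p.1 * √3 / 2 *
          ((j - j') + (haggLabel alternatingHagg k - haggLabel alternatingHagg k') / 3)) ^ 2 +
        ((k - k') * p.2) ^ 2) := by
    funext p
    rw [← dist_barlowPos_sq, Real.sqrt_sq dist_nonneg]
  rw [e]
  exact Real.continuous_sqrt.comp (by fun_prop)

/-! ## The energy per particle of `hcp(a,h)` against a compactly supported test potential -/

/-- A compactly supported function vanishes beyond some radius `R ≥ 0`. [folklore] -/
theorem exists_eq_zero_of_hasCompactSupport {W : ℝ → ℝ} (hWc : HasCompactSupport W) :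
    ∃ R : ℝ, 0 ≤ R ∧ ∀ r, R < r → W r = 0 := by
  obtain ⟨R, hR⟩ := (Metric.isBounded_iff_subset_closedBall (0 : ℝ)).1 hWc.isCompact.isBounded
  refine ⟨max R 0, le_max_right _ _, fun r hr => image_eq_zero_of_notMem_tsupport fun hmem => ?_⟩
  have h1 := hR hmem
  rw [Metric.mem_closedBall, Real.dist_eq, sub_zero] at h1
  have h2 : r ≤ R := (le_abs_self r).trans h1
  linarith [le_max_left R 0]

/-- The motif of `hcpPeriodicConfiguration ha hh` is parametrised injectively by `m ∈ {0,1}`,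
`m ↦ barlowPos a h alternatingHagg m 0 0` (the two points lie in the planes `x₃ = 0` and
`x₃ = h ≠ 0`). [folklore] -/
theorem hcp_motif_injOn {a h : ℝ} (hh : h ≠ 0) :
    Set.InjOn (fun m : ℕ => barlowPos a h alternatingHagg m 0 0) ↑(Finset.range 2) := by
  intro m _ m' _ heq
  have e2 := congrArg (fun z : EuclideanSpace ℝ (Fin 3) => z 2) heq
  simp only [barlowPos_apply_two, Int.cast_natCast] at e2
  have : (m : ℝ) = m' := mul_right_cancel₀ hh e2
  exact_mod_cast this

/-- **The energy per particle of the relaxed hcp family against a continuous compactly supported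
test potential is a continuous function of the two spacings** on the quadrant `a, h ≥ 1/2`:
there is a continuous `g : ℝ × ℝ → ℝ` with `e_{hcp(a,h)}(W) = g(a,h)` for all `a, h ≥ 1/2`.
Indeed only the finitely many index vectors `v ∈ ℤ³` whose point is within the range `R` of `W`
of a motif point already at `(a,h) = (1/2,1/2)` can contribute (distances are monotone in
`(a,h)`, `dist_hcp_mono`; local finiteness of `hcp(1/2,1/2)`), and each term
`W(dist(Φ_{a,h} v₀, Φ_{a,h} v))` is continuous in `(a,h)`. [folklore] -/
theorem exists_continuous_hcp_energyPerParticle {W : ℝ → ℝ} (hW : Continuous W)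
    (hWc : HasCompactSupport W) :
    ∃ g : ℝ × ℝ → ℝ, Continuous g ∧
      ∀ (a h : ℝ) (ha : a ≠ 0) (hh : h ≠ 0), 1 / 2 ≤ a → 1 / 2 ≤ h →
        (hcpPeriodicConfiguration ha hh).energyPerParticle W = g (a, h) := by
  classical
  obtain ⟨R, hR0, hR⟩ := exists_eq_zero_of_hasCompactSupport hWc
  -- the reference configuration `hcp(1/2,1/2)` and its point map
  have h2 : (1 / 2 : ℝ) ≠ 0 := by norm_num
  set Φ₁ : ℤ × ℤ × ℤ → EuclideanSpace ℝ (Fin 3) :=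
    fun v => barlowPos (1 / 2) (1 / 2) alternatingHagg v.1 v.2.1 v.2.2 with hΦ₁
  -- the finite index sets: vectors within range `R` of the motif point `m` at `(1/2,1/2)`
  have hfin : ∀ v₀ : ℤ × ℤ × ℤ, {v : ℤ × ℤ × ℤ | dist (Φ₁ v₀) (Φ₁ v) ≤ R}.Finite := by
    intro v₀
    have hf := ((hcpPeriodicConfiguration h2 h2).finite_inter_points
      (Metric.isBounded_closedBall (x := Φ₁ v₀) (r := R))).preimage (hcp_injective h2 h2).injOn
    refine hf.subset fun v hv => ?_
    refine ⟨?_, (mem_hcp_points_iff h2 h2 _).2 ⟨v, rfl⟩⟩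
    rw [Metric.mem_closedBall, dist_comm]
    exact hv
  set B : (ℤ × ℤ × ℤ) → Finset (ℤ × ℤ × ℤ) := fun v₀ => (hfin v₀).toFinset with hB
  have hmemB : ∀ v₀ v, v ∈ B v₀ ↔ dist (Φ₁ v₀) (Φ₁ v) ≤ R := fun v₀ v => by
    rw [hB]
    exact (hfin v₀).mem_toFinset
  -- the continuous function
  refine ⟨fun p => (2 * 2 : ℝ)⁻¹ * ∑ m ∈ Finset.range 2, ∑ v ∈ B ((m : ℤ), 0, 0),
      if v = ((m : ℤ), 0, 0) then 0 else
        W (dist (barlowPos p.1 p.2 alternatingHagg (m : ℤ) 0 0)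
          (barlowPos p.1 p.2 alternatingHagg v.1 v.2.1 v.2.2)), ?_, ?_⟩
  · refine continuous_const.mul (continuous_finsetSum _ fun m _ => ?_)
    refine continuous_finsetSum _ fun v _ => ?_
    split_ifs
    · exact continuous_const
    · exact hW.comp (continuous_dist_hcp (m : ℤ) 0 0 v.1 v.2.1 v.2.2)
  · intro a h ha hh ha2 hh2
    -- beyond the finite index set the test potential vanishes, for every `a, h ≥ 1/2`
    have hvan : ∀ (v₀ v : ℤ × ℤ × ℤ), v ∉ B v₀ →
        (if v = v₀ then 0 else
          W (dist (barlowPos a h alternatingHagg v₀.1 v₀.2.1 v₀.2.2)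
            (barlowPos a h alternatingHagg v.1 v.2.1 v.2.2))) = 0 := by
      intro v₀ v hv
      rw [hmemB, not_le] at hv
      split_ifs
      · rfl
      · refine hR _ (hv.trans_le ?_)
        exact dist_hcp_mono (by norm_num) ha2 (by norm_num) hh2 _ _ _ _ _ _
    -- the site sum at the motif point `m` is the finite sum over `B (m,0,0)`
    have hsite : ∀ m : ℕ,
        ∑' y : {y // y ∈ (hcpPeriodicConfiguration ha hh).points ∧
          y ≠ barlowPos a h alternatingHagg (m : ℤ) 0 0},
            W (dist (barlowPos a h alternatingHagg (m : ℤ) 0 0) y.1) =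
        ∑ v ∈ B ((m : ℤ), 0, 0), if v = ((m : ℤ), 0, 0) then 0 else
          W (dist (barlowPos a h alternatingHagg (m : ℤ) 0 0)
            (barlowPos a h alternatingHagg v.1 v.2.1 v.2.2)) := by
      intro m
      rw [tsum_hcp_site_eq ha hh ((m : ℤ), 0, 0)
        (fun y => W (dist (barlowPos a h alternatingHagg (m : ℤ) 0 0) y))]
      exact tsum_eq_sum fun v hv => hvan ((m : ℤ), 0, 0) v hv
    -- assemble: the motif is `{Φ(m,0,0) : m < 2}`, of cardinality `2`
    have hmotif : (hcpPeriodicConfiguration ha hh).motif =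
        (Finset.range 2).image fun m : ℕ => barlowPos a h alternatingHagg m 0 0 := rfl
    have hcard : ((hcpPeriodicConfiguration ha hh).motif.card : ℝ) = 2 := by
      rw [hmotif, Finset.card_image_of_injOn (hcp_motif_injOn hh), Finset.card_range]
      norm_num
    unfold PeriodicConfiguration.energyPerParticle
    rw [hcard, hmotif, Finset.sum_image (hcp_motif_injOn hh)]
    congr 1
    exact Finset.sum_congr rfl fun m _ => hsite m

end Summit.AtomisticToContinuum.Crystallization.Theorems.EnergyDerivativeOrderDanskin

end
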